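import Literature.NumberTheory.Automorphic.GLnBiWhittakerAveraging
import HarnessLib

/-!
# Gelfand–Kazhdan's theorem: bi-`ψ_U`-quasi-invariant distributions on `GL_n(F)` are stable under
`ι(g) = w⁰ ᵗg w⁰` (all `n`)

Topic `NumberTheory/Automorphic`. Second half (after `GLnBiWhittakerAveraging`) of the proof of
**Theorem A** of Gelfand–Kazhdan (1975, §§3–4; Bernstein–Zelevinsky 1976, §§5.16–5.17, proved in §7 by
the method of §6; Bump 1997, Thm. 4.4.2, proved there for `n = 2` only):

* `biWhittaker_gkInvolution_stable` — for a non-trivial continuous `ψ`, every distribution `Δ` on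
  `GL_n(F)` with `Δ(λ(u) φ) = ψ_U(u) Δ(φ)` and `Δ(ρ(u) φ) = ψ_U(u)⁻¹ Δ(φ)` (`u ∈ U_n`; Bump's (4.1) in
  the conventions (3.4)–(3.5)) satisfies `Δ(φ ∘ ι) = Δ(φ)`.

This is exactly the hypothesis `hA` of the tree's Gelfand–Kazhdan criteria
(`rank_whittakerFunctionals_le_one_of_gelfandKazhdan`, `…_pair`,
`…_of_isSupercuspidal_of_gelfandKazhdan`), which it discharges (the corollaries — multiplicity one
for irreducible supercuspidal representations, unconditionally, and for irreducible admissible `π`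
with `ψ⁻¹`-generic contragredient — are drawn in the sibling file
`WhittakerModelsMultiplicityOneSupercuspidal`).

## The proof (Gelfand–Kazhdan's method, in coinvariant form)

By `gkInvolution_stable_of_gkRelations_eq_top` it suffices that every test function lies in
`gkRelations ψ = span {h · f - biChar(h) f} + span {J f + f}`. We prove by downward induction on `r`
that every `f ∈ C_c^∞(G)` vanishing on the closed set `levelLT r = ⋃_{rankSum σ < r} B P_σ U`
(`BorelBruhatCellsGK`) lies in `gkRelations ψ` (`mem_gkRelations_of_forall_levelLT`); for large `r`
the level is all of `G` and the claim is trivial, and for `r = 0` (empty level) it is the theorem.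
For the induction step, the part of the support of `f` inside `levelLT (r+1)` is a compact subset
of the disjoint union of the (relatively open) cells of rank sum `r`; cutting `f` off along
pairwise disjoint compact open sets (total disconnectedness, `exists_disjoint_isCompact_isOpen`)
reduces to `f` supported, within `levelLT (r+1)`, in one cell `C = C_σ` (`mem_gkRelations_cell`).
There, Bernstein's localization principle (Bernstein–Zelevinsky 1976, §6) is carried out by hand
along the torus coordinate `q = cellTorus σ` (continuous on the cell, fibres = `U × U`-orbits):
for each base point `g` one averages over `V₀ × V₀` for a `τ`-stable compact open `V₀ ≤ U_n` large
enough (`exists_localData`): if the orbit of `m_g = q(g) P_σ` is *irrelevant* (some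
`(m u m⁻¹, u)` in the stabiliser with `ψ_U(m u m⁻¹) ≠ ψ_U(u)`, `GLnWhittakerRelevantOrbits`) then
`e f` vanishes on the orbits of `m_g` and `ι(m_g)`; if it is *relevant* then `ι(m_g) = m_g`
(Gelfand–Kazhdan's lemma `gkInvolution_eq_self_of_relevant`) and `e f - J(e f)` vanishes on the
orbit. In both cases `f ≡ res_g f` modulo `gkRelations ψ` with `res_g f` vanishing on `q⁻¹(Ω_g) ∩ C`
for an open `♯`-stable `Ω_g ∋ q(g)` (`♯ = cellSharp σ` the involution induced by `ι` on torus
coordinates). A finite `♯`-stable disjoint compact open refinement of the `Ω_g` covering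
`q(K) ∪ ♯ q(K)` (`exists_sharp_refinement`) and the corresponding cut-offs `f_i` of `f` finish the
step, because cutting off along `q` commutes with the averaging and with `J` on the cell
(`localData` (P4)).

Everything is proved; no named fact is introduced. (The distribution-theoretic inputs of the
printed proofs — restriction of distributions to locally closed subsets, quasi-invariant
distributions on homogeneous spaces, the localization principle — are replaced by their
finite-averaging counterparts on `C_c^∞(G)` itself.)

## References

* I. M. Gelfand, D. A. Kazhdan, *Representations of the group GL(n, K) where K is a local field*,
  in: Lie groups and their representations (Budapest 1971), Halsted (1975), 95–118, §§3–4.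
  [GelfandKazhdan1975]
* I. N. Bernstein, A. V. Zelevinsky, *Representations of the group GL(n, F) where F is a
  non-archimedean local field*, Russian Math. Surveys 31:3 (1976), 1–68, §§5.16–5.17, §6
  (localization principle, Gelfand–Kazhdan's method), §7 (not held). [BernsteinZelevinskyRMS1976]
* D. Bump, *Automorphic Forms and Representations* (1997), Theorem 4.4.2 (p. 455) and its proof for
  `GL(2)`, pp. 456–457; §4.3, Propositions 4.3.2–4.3.3. [Bump1997]
-/

open Matrix Topology
open scoped Pointwise

namespace Literature.NumberTheory.Automorphic

/-! ### Point-set lemmas in locally compact totally disconnected spaces -/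

section TotallyDisconnected

variable {T : Type*} [TopologicalSpace T] [LocallyCompactSpace T] [T2Space T] [TotallyDisconnectedSpace T]

/-- **Compact open sets separate compact sets from closed sets**: a compact `K` inside an open `U`
lies in a compact open `L ⊆ U` (locally compact Hausdorff totally disconnected spaces have a basis
of compact open sets). [folklore] -/
theorem exists_isCompact_isOpen_between {K U : Set T} (hK : IsCompact K) (hU : IsOpen U) (hKU : K ⊆ U) :
    ∃ L : Set T, IsCompact L ∧ IsOpen L ∧ K ⊆ L ∧ L ⊆ U := by
  have hbasis := loc_compact_Haus_tot_disc_of_zero_dim (H := T)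
  -- a compact open neighbourhood inside `U` of each point of `K`
  have hx : ∀ x ∈ K, ∃ V : Set T, IsCompact V ∧ IsOpen V ∧ x ∈ V ∧ V ⊆ U := by
    intro x hxK
    obtain ⟨s, hsc, hxs, hsU⟩ := exists_compact_subset hU (hKU hxK)
    obtain ⟨V, hVclopen, hxV, hVs⟩ := hbasis.exists_subset_of_mem_open hxs isOpen_interior
    exact ⟨V, hsc.of_isClosed_subset hVclopen.1 (hVs.trans interior_subset), hVclopen.2, hxV,
      (hVs.trans interior_subset).trans hsU⟩
  choose! V hVc hVo hxV hVU using hx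
  obtain ⟨t, htK, htfin, hcover⟩ := hK.elim_finite_subcover_image (fun x hx => hVo x hx)
    fun x hx => Set.mem_biUnion hx (hxV x hx)
  refine ⟨⋃ x ∈ t, V x, htfin.isCompact_biUnion fun x hx => hVc x (htK hx),
    isOpen_biUnion fun x hx => hVo x (htK hx), hcover, Set.iUnion₂_subset fun x hx => hVU x (htK hx)⟩

/-- **Pairwise disjoint compact sets have pairwise disjoint compact open neighbourhoods** (finite
families). [folklore] -/
theorem exists_disjoint_isCompact_isOpen {ι : Type*} [Fintype ι] {P : ι → Set T}
    (hPc : ∀ i, IsCompact (P i)) (hPd : Pairwise (Function.onFun Disjoint P)) :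
    ∃ W : ι → Set T, (∀ i, IsCompact (W i)) ∧ (∀ i, IsOpen (W i)) ∧ (∀ i, P i ⊆ W i) ∧
      Pairwise (Function.onFun Disjoint W) := by
  classical
  -- `L i` compact open, `P i ⊆ L i`, `L i ∩ P j = ∅` for `j ≠ i`
  have hL : ∀ i, ∃ L : Set T, IsCompact L ∧ IsOpen L ∧ P i ⊆ L ∧ L ⊆ (⋃ j ∈ ({i}ᶜ : Finset ι), P j)ᶜ := by
    intro i
    refine exists_isCompact_isOpen_between (hPc i) ?_ ?_
    · exact (Finset.isCompact_biUnion _ fun j _ => hPc j).isClosed.isOpen_compl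
    · rw [Set.subset_compl_iff_disjoint_right, Set.disjoint_iUnion₂_right]
      intro j hj
      exact hPd (Ne.symm (by simpa using hj))
  choose L hLc hLo hPL hLd using hL
  -- disjointify along an enumeration
  set e := Fintype.equivFin ι with he
  refine ⟨fun i => L i \ ⋃ (j : ι) (_ : e j < e i), L j, fun i => ?_, fun i => ?_, fun i => ?_, ?_⟩
  · exact (hLc i).diff (isOpen_biUnion fun j _ => hLo j)
  · exact (hLo i).sdiff (Set.Finite.isClosed_biUnion (Set.toFinite _) fun j _ => (hLc j).isClosed)
  · intro x hx
    refine ⟨hPL i hx, ?_⟩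
    simp only [Set.mem_iUnion, not_exists]
    intro j hji hxj
    have hne : j ≠ i := fun h => by rw [h] at hji; exact lt_irrefl _ hji
    have := hLd j hxj
    simp only [Set.mem_compl_iff, Set.mem_iUnion, not_exists] at this
    exact this i (by simpa using hne.symm) hx
  · intro i j hij
    rcases lt_or_gt_of_ne (fun h : e i = e j => hij (e.injective h)) with h | h
    · exact Set.disjoint_left.2 fun x hxi hxj => hxj.2 (Set.mem_biUnion h hxi.1)
    · exact Set.disjoint_left.2 fun x hxi hxj => hxi.2 (Set.mem_biUnion h hxj.1)

/-- **`♯`-stable disjoint refinements.** Let `♯` be a continuous involution of `T`, `Q ⊆ T` compact,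
and `Ω i` (`i ∈ ι`, finite) open `♯`-stable sets covering `Q`. Then there are
pairwise disjoint, `♯`-stable, compact open `Ω' i ⊆ Ω i` still covering `Q`. [folklore] -/
theorem exists_sharp_refinement {ι : Type*} [Fintype ι] {sharp : T → T} (hcont : Continuous sharp)
    (hinv : Function.Involutive sharp) {Q : Set T} (hQ : IsCompact Q)
    {Ω : ι → Set T} (hΩo : ∀ i, IsOpen (Ω i)) (hΩs : ∀ i, Set.MapsTo sharp (Ω i) (Ω i))
    (hcov : Q ⊆ ⋃ i, Ω i) :
    ∃ Ω' : ι → Set T, (∀ i, IsCompact (Ω' i)) ∧ (∀ i, IsOpen (Ω' i)) ∧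
      (∀ i, Set.MapsTo sharp (Ω' i) (Ω' i)) ∧ (∀ i, Ω' i ⊆ Ω i) ∧
      Pairwise (Function.onFun Disjoint Ω') ∧ Q ⊆ ⋃ i, Ω' i := by
  classical
  -- trivial when `Q = ∅`
  rcases Q.eq_empty_or_nonempty with hQe | ⟨x₀, hx₀⟩
  · refine ⟨fun _ => ∅, fun _ => isCompact_empty, fun _ => isOpen_empty, fun _ => Set.mapsTo_empty _ _,
      fun _ => Set.empty_subset _, fun i j _ => ?_, by rw [hQe]; exact Set.empty_subset _⟩
    simp [Function.onFun]
  haveI : Nonempty ι := ⟨Classical.choose (Set.mem_iUnion.1 (hcov hx₀))⟩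
  have hpre : ∀ s : Set T, sharp ⁻¹' s = sharp '' s := fun s =>
    (congrFun (Set.image_eq_preimage_of_inverse hinv.leftInverse hinv.rightInverse) s).symm
  -- Step 1: a `♯`-stable compact open neighbourhood of each point of `Q` inside some `Ω i`
  have hx : ∀ x ∈ Q, ∃ i, ∃ B : Set T, IsCompact B ∧ IsOpen B ∧ Set.MapsTo sharp B B ∧ x ∈ B ∧ B ⊆ Ω i := by
    intro x hxQ
    obtain ⟨i, hxi⟩ := Set.mem_iUnion.1 (hcov hxQ)
    obtain ⟨B, hBc, hBo, hxB, hBΩ⟩ := exists_isCompact_isOpen_between isCompact_singleton (hΩo i)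
      (Set.singleton_subset_iff.2 hxi)
    refine ⟨i, B ∪ sharp ⁻¹' B, hBc.union (by rw [hpre]; exact hBc.image hcont),
      hBo.union (hBo.preimage hcont), ?_, Or.inl (hxB rfl), Set.union_subset hBΩ ?_⟩
    · rintro y (hy | hy)
      · right; show sharp (sharp y) ∈ B; rw [hinv y]; exact hy
      · exact Or.inl hy
    · intro y hy
      have : sharp y ∈ Ω i := hBΩ hy
      have h2 := hΩs i this
      rwa [hinv y] at h2
  choose! idx B hBc hBo hBs hxB hBΩ using hx
  obtain ⟨t, htQ, htfin, hcovB⟩ := hQ.elim_finite_subcover_image (fun x hx => hBo x hx)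
    fun x hx => Set.mem_biUnion hx (hxB x hx)
  -- Step 2: `A i = ⋃ {B x : x ∈ t, idx x = i}`
  set A : ι → Set T := fun i => ⋃ x ∈ {x ∈ t | idx x = i}, B x with hA
  have hAc : ∀ i, IsCompact (A i) := fun i =>
    (htfin.subset (Set.sep_subset _ _)).isCompact_biUnion fun x hx => hBc x (htQ hx.1)
  have hAo : ∀ i, IsOpen (A i) := fun i =>
    isOpen_biUnion fun x hx => hBo x (htQ hx.1)
  have hAs : ∀ i, Set.MapsTo sharp (A i) (A i) := by
    intro i y hy
    simp only [hA, Set.mem_iUnion] at hy ⊢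
    obtain ⟨x, hx, hyx⟩ := hy
    exact ⟨x, hx, hBs x (htQ hx.1) hyx⟩
  have hAΩ : ∀ i, A i ⊆ Ω i := by
    intro i y hy
    simp only [hA, Set.mem_iUnion] at hy
    obtain ⟨x, hx, hyx⟩ := hy
    obtain ⟨hxt, hxi⟩ := hx
    rw [← hxi]
    exact hBΩ x (htQ hxt) hyx
  have hAcov : Q ⊆ ⋃ i, A i := by
    intro y hy
    obtain ⟨x, hxt, hyx⟩ := Set.mem_iUnion₂.1 (hcovB hy)
    refine Set.mem_iUnion.2 ⟨idx x, ?_⟩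
    simp only [hA, Set.mem_iUnion]
    exact ⟨x, ⟨hxt, rfl⟩, hyx⟩
  -- Step 3: disjointify along an enumeration
  set e := Fintype.equivFin ι with he
  refine ⟨fun i => A i \ ⋃ (j : ι) (_ : e j < e i), A j, fun i => ?_, fun i => ?_, fun i => ?_,
    fun i => fun y hy => hAΩ i hy.1, ?_, ?_⟩
  · exact (hAc i).diff (isOpen_biUnion fun j _ => hAo j)
  · exact (hAo i).sdiff (Set.Finite.isClosed_biUnion (Set.toFinite _) fun j _ => (hAc j).isClosed)
  · intro y hy
    refine ⟨hAs i hy.1, ?_⟩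
    simp only [Set.mem_iUnion, not_exists]
    intro j hji hyj
    apply hy.2
    refine Set.mem_biUnion hji ?_
    have := hAs j hyj
    rwa [hinv y] at this
  · intro i j hij
    rcases lt_or_gt_of_ne (fun h : e i = e j => hij (e.injective h)) with h | h
    · exact Set.disjoint_left.2 fun x hxi hxj => hxj.2 (Set.mem_biUnion h hxi.1)
    · exact Set.disjoint_left.2 fun x hxi hxj => hxi.2 (Set.mem_biUnion h hxj.1)
  · intro y hy
    -- the `e`-minimal index `i` with `y ∈ A i`
    set s : Finset ι := Finset.univ.filter fun i => y ∈ A i with hs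
    have hsne : s.Nonempty := by
      obtain ⟨i, hi⟩ := Set.mem_iUnion.1 (hAcov hy)
      exact ⟨i, Finset.mem_filter.2 ⟨Finset.mem_univ _, hi⟩⟩
    obtain ⟨i, his, hmin⟩ := s.exists_min_image (fun i => ((e i : Fin _) : ℕ)) hsne
    refine Set.mem_iUnion.2 ⟨i, (Finset.mem_filter.1 his).2, ?_⟩
    simp only [Set.mem_iUnion, not_exists]
    intro j hj hyj
    have := hmin j (Finset.mem_filter.2 ⟨Finset.mem_univ _, hyj⟩)
    exact absurd (Fin.lt_def.1 hj) (not_lt.2 this)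

end TotallyDisconnected

/-! ### Cut-offs, supports, and the torus involution `♯` -/

section LocalField

variable {F : Type*} [Field F] [ValuativeRel F] [TopologicalSpace F] [IsNonarchimedeanLocalField F]
  {n : ℕ}

attribute [local instance] t2Space_generalLinearGroup locallyCompactSpace_generalLinearGroup
  nonarchimedeanGroup_gl sigmaCompactSpace_generalLinearGroup

/-- The **cut-off** `1_W · f` of a test function along a clopen set `W`. [folklore] -/
noncomputable def SchwartzBruhat.cutoff (W : Set (GL (Fin n) F)) (hW : IsClopen W)
    (f : SchwartzBruhat (GL (Fin n) F)) : SchwartzBruhat (GL (Fin n) F) :=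
  ⟨fun x => (f : GL (Fin n) F → ℂ) x * W.indicator (fun _ => (1 : ℂ)) x,
    by
      classical
      refine mul_mem_schwartzBruhat f.2 ?_
      refine (IsLocallyConstant.iff_exists_open _).2 fun x => ?_
      by_cases hx : x ∈ W
      · exact ⟨W, hW.2, hx, fun y hy => by rw [Set.indicator_of_mem hy, Set.indicator_of_mem hx]⟩
      · exact ⟨Wᶜ, hW.1.isOpen_compl, hx, fun y hy => by
          rw [Set.indicator_of_notMem hy, Set.indicator_of_notMem hx]⟩⟩

omit [ValuativeRel F] [IsNonarchimedeanLocalField F] in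
open scoped Classical in
/-- Pointwise: `(1_W · f)(x) = f(x)` on `W` and `0` off `W`. [folklore] -/
lemma SchwartzBruhat.cutoff_apply (W : Set (GL (Fin n) F)) (hW : IsClopen W)
    (f : SchwartzBruhat (GL (Fin n) F)) (x : GL (Fin n) F) :
    (SchwartzBruhat.cutoff W hW f : GL (Fin n) F → ℂ) x = if x ∈ W then (f : GL (Fin n) F → ℂ) x else 0 := by
  change (f : GL (Fin n) F → ℂ) x * W.indicator (fun _ => (1 : ℂ)) x = _
  by_cases hx : x ∈ W
  · rw [Set.indicator_of_mem hx, mul_one, if_pos hx]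
  · rw [Set.indicator_of_notMem hx, mul_zero, if_neg hx]

omit [ValuativeRel F] [IsNonarchimedeanLocalField F] in
/-- **The non-vanishing set of a test function meets a closed set in a compact set** (it is clopen
and relatively compact). [folklore] -/
theorem SchwartzBruhat.isCompact_ne_inter (f : SchwartzBruhat (GL (Fin n) F)) {Z : Set (GL (Fin n) F)}
    (hZ : IsClosed Z) : IsCompact ({x | (f : GL (Fin n) F → ℂ) x ≠ 0} ∩ Z) := by
  have hcl : IsClosed {x | (f : GL (Fin n) F → ℂ) x ≠ 0} := by
    have : {x | (f : GL (Fin n) F → ℂ) x ≠ 0} = ((f : GL (Fin n) F → ℂ) ⁻¹' {0})ᶜ := by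
      ext x; simp
    rw [this]
    exact (f.2.1.isOpen_fiber 0).isClosed_compl
  refine (f.2.2.of_isClosed_subset (hcl.inter hZ) ?_)
  intro x hx
  exact subset_tsupport _ hx.1

/-- The **torus involution** `♯` attached to a cell: `cellSharp σ` (conjugation by `P_σ w⁰`) when
the cell is `ι`-stable (`σ⋆ = σ`), the identity otherwise. [folklore] -/
noncomputable def torusSharp (σ : Equiv.Perm (Fin n)) (x : GL (Fin n) F) : GL (Fin n) F :=
  if starPerm σ = σ then cellSharp σ x else x

omit [ValuativeRel F] [TopologicalSpace F] [IsNonarchimedeanLocalField F] in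
/-- `♯` on an `ι`-stable cell. [folklore] -/
lemma torusSharp_of_eq {σ : Equiv.Perm (Fin n)} (hσ : starPerm σ = σ) (x : GL (Fin n) F) :
    torusSharp σ x = cellSharp σ x := if_pos hσ

omit [ValuativeRel F] [TopologicalSpace F] [IsNonarchimedeanLocalField F] in
/-- `♯` on a cell that is not `ι`-stable. [folklore] -/
lemma torusSharp_of_ne {σ : Equiv.Perm (Fin n)} (hσ : starPerm σ ≠ σ) (x : GL (Fin n) F) :
    torusSharp σ x = x := if_neg hσ

omit [ValuativeRel F] [TopologicalSpace F] [IsNonarchimedeanLocalField F] in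
/-- `♯` is an involution. [folklore] -/
lemma torusSharp_involutive (σ : Equiv.Perm (Fin n)) : Function.Involutive (torusSharp (F := F) σ) := by
  intro x
  by_cases hσ : starPerm σ = σ
  · rw [torusSharp_of_eq hσ, torusSharp_of_eq hσ, cellSharp_cellSharp hσ]
  · rw [torusSharp_of_ne hσ, torusSharp_of_ne hσ]

omit [ValuativeRel F] [IsNonarchimedeanLocalField F] in
/-- `♯` is continuous. [folklore] -/
lemma continuous_torusSharp [IsTopologicalRing F] (σ : Equiv.Perm (Fin n)) :
    Continuous (torusSharp (F := F) σ) := by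
  by_cases hσ : starPerm σ = σ
  · have : torusSharp (F := F) σ = cellSharp σ := funext (torusSharp_of_eq hσ)
    rw [this]
    exact (continuous_const.mul continuous_id).mul continuous_const
  · have : torusSharp (F := F) σ = _root_.id := funext (torusSharp_of_ne hσ)
    rw [this]; exact continuous_id

omit [ValuativeRel F] [IsNonarchimedeanLocalField F] in
/-- **The torus coordinate of `ι(y)` is `♯` of that of `y`** on an `ι`-stable cell. [folklore] -/
lemma cellTorus_gkInvolution_eq_torusSharp {σ : Equiv.Perm (Fin n)} (hσ : starPerm σ = σ)
    {y : GL (Fin n) F} (hy : y ∈ bruhatCell (K := F) σ) :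
    cellTorus σ (gkInvolution y) = torusSharp σ (cellTorus σ y) := by
  rw [torusSharp_of_eq hσ, cellTorus_gkInvolution hσ hy]

/-! ### General facts used in the localization -/

variable (ψ : AddChar F Circle)

omit [ValuativeRel F] [IsNonarchimedeanLocalField F] in
/-- Uniformity in the form consumed by the orbit lemmas: from `y = u₁ m_y u₂` with `u₁, u₂` in a
compact `C_u ⊆ V₀` to `y = h · m_y` with `h ∈ V₀ × V₀`. [folklore] -/
lemma hunif_of_subset {σ : Equiv.Perm (Fin n)} {f : SchwartzBruhat (GL (Fin n) F)}
    {C_u : Set ↥(upperUnitriangular (Fin n) F)}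
    (hunif : ∀ y ∈ bruhatCell (K := F) σ, (f : GL (Fin n) F → ℂ) y ≠ 0 →
      ∃ u₁ ∈ C_u, ∃ u₂ ∈ C_u, y = (u₁ : GL (Fin n) F) * (cellTorus σ y * permGL σ) * (u₂ : GL (Fin n) F))
    {V₀ : Subgroup ↥(upperUnitriangular (Fin n) F)} (hCV : C_u ⊆ V₀) :
    ∀ y ∈ bruhatCell (K := F) σ, (f : GL (Fin n) F → ℂ) y ≠ 0 →
      ∃ h ∈ V₀.prod V₀, y = biAct h (cellTorus σ y * permGL σ) := by
  intro y hy h0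
  obtain ⟨u₁, hu₁, u₂, hu₂, hyu⟩ := hunif y hy h0
  refine ⟨(u₁, u₂⁻¹), Subgroup.mem_prod.2 ⟨hCV hu₁, V₀.inv_mem (hCV hu₂)⟩, ?_⟩
  rw [biAct_apply, Subgroup.coe_inv, inv_inv]
  exact hyu

/-- **Averaging does not spread the support out of the cell**: if `φ` vanishes on `Z ∖ C`
(`Z = levelLT r`, `C` a cell, both `U × U`-stable) then so does `e φ`. [folklore] -/
theorem biAvg_apply_eq_zero_of_forall (hψ : Continuous ψ) {V₀ : Subgroup ↥(upperUnitriangular (Fin n) F)}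
    (hV₀ : IsCompact (V₀ : Set ↥(upperUnitriangular (Fin n) F))) {σ : Equiv.Perm (Fin n)} {r : ℕ}
    {φ : SchwartzBruhat (GL (Fin n) F)}
    (hφ : ∀ x ∈ levelLT (K := F) r, x ∉ bruhatCell (K := F) σ → (φ : GL (Fin n) F → ℂ) x = 0) :
    ∀ x ∈ levelLT (K := F) r, x ∉ bruhatCell (K := F) σ → (biAvg ψ V₀ φ : GL (Fin n) F → ℂ) x = 0 := by
  intro x hxZ hxC
  by_contra h0
  obtain ⟨h, -, hh0⟩ := exists_apply_ne_zero_of_biAvg_ne_zero ψ V₀ hψ hV₀ φ h0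
  apply hh0
  apply hφ
  · rw [biAct_apply]
    exact mul_mul_mem_levelLT hxZ (h⁻¹).1.2 (Subgroup.inv_mem _ (h⁻¹).2.2)
  · intro hC
    apply hxC
    have := mul_mul_mem_bruhatCell σ hC h.1.2 (Subgroup.inv_mem _ h.2.2)
    rwa [biAct_apply, ← biAct_apply, ← biAct_apply, biAct_biAct_inv] at this

/-- `J` does not spread the support out of an `ι`-stable cell. [folklore] -/
theorem compGKInvolution_apply_eq_zero_of_forall {σ : Equiv.Perm (Fin n)} (hσ : starPerm σ = σ) {r : ℕ}
    {φ : SchwartzBruhat (GL (Fin n) F)}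
    (hφ : ∀ x ∈ levelLT (K := F) r, x ∉ bruhatCell (K := F) σ → (φ : GL (Fin n) F → ℂ) x = 0) :
    ∀ x ∈ levelLT (K := F) r, x ∉ bruhatCell (K := F) σ →
      (SchwartzBruhat.compGKInvolution φ : GL (Fin n) F → ℂ) x = 0 := by
  intro x hxZ hxC
  rw [SchwartzBruhat.compGKInvolution_apply]
  refine hφ _ (gkInvolution_mem_levelLT hxZ) fun hC => hxC ?_
  have := (gkInvolution_mem_bruhatCell_iff σ (gkInvolution x)).2 hC
  rwa [gkInvolution_gkInvolution, hσ] at this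

open scoped Classical in
/-- **Cutting off along the torus coordinate commutes with averaging on the cell.** If for the
points `y` of the cell with `f(y) ≠ 0` one has `y ∈ W ↔ cellTorus σ y ∈ Ω'`, then for every `y` in
the cell `(e (1_W f))(y) = [cellTorus σ y ∈ Ω'] (e f)(y)`. [folklore] -/
theorem biAvg_cutoff_apply (hψ : Continuous ψ) {V₀ : Subgroup ↥(upperUnitriangular (Fin n) F)}
    (hV₀ : IsCompact (V₀ : Set ↥(upperUnitriangular (Fin n) F))) {σ : Equiv.Perm (Fin n)}
    {f : SchwartzBruhat (GL (Fin n) F)} {W Ω' : Set (GL (Fin n) F)} (hW : IsClopen W)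
    (hcompat : ∀ y ∈ bruhatCell (K := F) σ, (f : GL (Fin n) F → ℂ) y ≠ 0 → (y ∈ W ↔ cellTorus σ y ∈ Ω'))
    {y : GL (Fin n) F} (hy : y ∈ bruhatCell (K := F) σ) :
    (biAvg ψ V₀ (SchwartzBruhat.cutoff W hW f) : GL (Fin n) F → ℂ) y =
      if cellTorus σ y ∈ Ω' then (biAvg ψ V₀ f : GL (Fin n) F → ℂ) y else 0 := by
  classical
  obtain ⟨R, -, -, hR₁, hR₂⟩ := exists_biAvg_eq_sum₂ ψ V₀ hψ hV₀ (SchwartzBruhat.cutoff W hW f) f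
  rw [hR₁, hR₂, sum_biRepTwist_apply, sum_biRepTwist_apply]
  have hterm : ∀ r ∈ R, ((biChar ψ r : ℂˣ) : ℂ)⁻¹ * (SchwartzBruhat.cutoff W hW f : GL (Fin n) F → ℂ) (biAct r⁻¹ y) =
      if cellTorus σ y ∈ Ω' then ((biChar ψ r : ℂˣ) : ℂ)⁻¹ * (f : GL (Fin n) F → ℂ) (biAct r⁻¹ y) else 0 := by
    intro r _
    have hy' : biAct r⁻¹ y ∈ bruhatCell (K := F) σ := by
      rw [biAct_apply]; exact mul_mul_mem_bruhatCell σ hy (r⁻¹).1.2 (Subgroup.inv_mem _ (r⁻¹).2.2)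
    have hT : cellTorus σ (biAct r⁻¹ y) = cellTorus σ y := by
      rw [biAct_apply]; exact cellTorus_mul_mul σ hy (r⁻¹).1.2 (Subgroup.inv_mem _ (r⁻¹).2.2)
    rw [SchwartzBruhat.cutoff_apply]
    by_cases h0 : (f : GL (Fin n) F → ℂ) (biAct r⁻¹ y) = 0
    · simp [h0]
    · rw [hcompat _ hy' h0, hT]
      by_cases hq : cellTorus σ y ∈ Ω' <;> simp [hq]
  rw [Finset.sum_congr rfl hterm]
  by_cases hq : cellTorus σ y ∈ Ω'
  · simp only [if_pos hq]
  · simp only [if_neg hq, Finset.sum_const_zero, mul_zero]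

open scoped Classical in
/-- The same after applying `J`, on an `ι`-stable cell and for a `♯`-stable `Ω'`. [folklore] -/
theorem compGKInvolution_biAvg_cutoff_apply (hψ : Continuous ψ) {V₀ : Subgroup ↥(upperUnitriangular (Fin n) F)}
    (hV₀ : IsCompact (V₀ : Set ↥(upperUnitriangular (Fin n) F))) {σ : Equiv.Perm (Fin n)} (hσ : starPerm σ = σ)
    {f : SchwartzBruhat (GL (Fin n) F)} {W Ω' : Set (GL (Fin n) F)} (hW : IsClopen W)
    (hΩ' : Set.MapsTo (torusSharp σ) Ω' Ω')
    (hcompat : ∀ y ∈ bruhatCell (K := F) σ, (f : GL (Fin n) F → ℂ) y ≠ 0 → (y ∈ W ↔ cellTorus σ y ∈ Ω'))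
    {y : GL (Fin n) F} (hy : y ∈ bruhatCell (K := F) σ) :
    (SchwartzBruhat.compGKInvolution (biAvg ψ V₀ (SchwartzBruhat.cutoff W hW f)) : GL (Fin n) F → ℂ) y =
      if cellTorus σ y ∈ Ω' then
        (SchwartzBruhat.compGKInvolution (biAvg ψ V₀ f) : GL (Fin n) F → ℂ) y else 0 := by
  have hιy : gkInvolution y ∈ bruhatCell (K := F) σ := by
    have := (gkInvolution_mem_bruhatCell_iff σ y).2 hy
    rwa [hσ] at this
  rw [SchwartzBruhat.compGKInvolution_apply, SchwartzBruhat.compGKInvolution_apply,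
    biAvg_cutoff_apply ψ hψ hV₀ hW hcompat hιy, cellTorus_gkInvolution_eq_torusSharp hσ hy]
  have hiff : torusSharp σ (cellTorus σ y) ∈ Ω' ↔ cellTorus σ y ∈ Ω' :=
    ⟨fun h => by simpa [torusSharp_involutive σ (cellTorus σ y)] using hΩ' h, fun h => hΩ' h⟩
  by_cases hq : cellTorus σ y ∈ Ω'
  · rw [if_pos (hiff.2 hq), if_pos hq]
  · rw [if_neg (fun h => hq (hiff.1 h)), if_neg hq]

/-! ### The local data at a base point of a cell -/

open scoped Classical in
/-- **Local data at a base point `g` of the cell `C = C_σ`** (the fibrewise step of the localization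
principle, Bernstein–Zelevinsky 1976, §6, carried out by finite averaging). Let `f` vanish on
`levelLT (rankSum σ + 1) ∖ C` and be uniform on `C` with respect to a compact `C_u ⊆ U_n`. Then for
every `g ∈ C` there are an operator `res` on test functions and an open `♯`-stable
`Ω ∋ cellTorus σ g` such that: (P1) `φ - res φ ∈ gkRelations ψ` for all `φ`; (P3) `res` preserves
vanishing on `levelLT (rankSum σ + 1) ∖ C`; (P2) `res f` vanishes at the points of `C` with torus
coordinate in `Ω`; (P4) `res` commutes with cut-offs along the torus coordinate on `C`. Here
`res = e_{V₀ × V₀}` if the orbit of `m_g = (cellTorus σ g) P_σ` is irrelevant, and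
`res = ½ (e - J e)` if it is relevant, in which case `ι(m_g) = m_g` by
`gkInvolution_eq_self_of_relevant`; `V₀` is a `τ`-stable compact open subgroup containing `C_u` and
the irrelevance witness. [cite: GelfandKazhdan1975, §4] [cite: Bump1997, Theorem 4.4.2 proof, pp. 455–457] -/
theorem exists_localData (hψ : ψ.IsContinuousNontrivial) (σ : Equiv.Perm (Fin n))
    {f : SchwartzBruhat (GL (Fin n) F)}
    (hfZ : ∀ x ∈ levelLT (K := F) (rankSum (_root_.id : Fin n → Fin n) σ + 1), x ∉ bruhatCell (K := F) σ →
      (f : GL (Fin n) F → ℂ) x = 0)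
    {C_u : Set ↥(upperUnitriangular (Fin n) F)} (hCu : IsCompact C_u)
    (hunif : ∀ y ∈ bruhatCell (K := F) σ, (f : GL (Fin n) F → ℂ) y ≠ 0 →
      ∃ u₁ ∈ C_u, ∃ u₂ ∈ C_u, y = (u₁ : GL (Fin n) F) * (cellTorus σ y * permGL σ) * (u₂ : GL (Fin n) F))
    {g : GL (Fin n) F} (hg : g ∈ bruhatCell (K := F) σ) :
    ∃ (res : SchwartzBruhat (GL (Fin n) F) → SchwartzBruhat (GL (Fin n) F)) (Ω : Set (GL (Fin n) F)),
      IsOpen Ω ∧ cellTorus σ g ∈ Ω ∧ Set.MapsTo (torusSharp σ) Ω Ω ∧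
      (∀ φ, φ - res φ ∈ gkRelations ψ) ∧
      (∀ φ : SchwartzBruhat (GL (Fin n) F),
        (∀ x ∈ levelLT (K := F) (rankSum (_root_.id : Fin n → Fin n) σ + 1), x ∉ bruhatCell (K := F) σ →
          (φ : GL (Fin n) F → ℂ) x = 0) →
        ∀ x ∈ levelLT (K := F) (rankSum (_root_.id : Fin n → Fin n) σ + 1), x ∉ bruhatCell (K := F) σ →
          (res φ : GL (Fin n) F → ℂ) x = 0) ∧
      (∀ y ∈ bruhatCell (K := F) σ, cellTorus σ y ∈ Ω → (res f : GL (Fin n) F → ℂ) y = 0) ∧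
      (∀ (W Ω' : Set (GL (Fin n) F)) (hW : IsClopen W), Set.MapsTo (torusSharp σ) Ω' Ω' →
        (∀ y ∈ bruhatCell (K := F) σ, (f : GL (Fin n) F → ℂ) y ≠ 0 → (y ∈ W ↔ cellTorus σ y ∈ Ω')) →
        ∀ y ∈ bruhatCell (K := F) σ, (res (SchwartzBruhat.cutoff W hW f) : GL (Fin n) F → ℂ) y =
          if cellTorus σ y ∈ Ω' then (res f : GL (Fin n) F → ℂ) y else 0) := by
  haveI : T2Space F := (GaloisRepresentations.IsNonarchimedeanLocalField.isLocalField F).toT2Space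
  have hψ1 : ψ ≠ 1 := hψ.2
  set Z := levelLT (K := F) (rankSum (_root_.id : Fin n → Fin n) σ + 1) with hZ
  have hZc : IsClosed Z := isClosed_levelLT _
  set q := cellTorus (K := F) σ with hq
  obtain ⟨d, hd⟩ := exists_diagonalGL_eq_cellTorus (K := F) σ g
  -- the generic construction of `Ω` from a residual operator with (P2') and (P3)
  have hΩ_of : ∀ (res : SchwartzBruhat (GL (Fin n) F) → SchwartzBruhat (GL (Fin n) F)),
      (∀ x ∈ Z, x ∉ bruhatCell (K := F) σ → (res f : GL (Fin n) F → ℂ) x = 0) →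
      (∀ y ∈ bruhatCell (K := F) σ, (q y = q g ∨ q y = torusSharp σ (q g)) → (res f : GL (Fin n) F → ℂ) y = 0) →
      ∃ Ω : Set (GL (Fin n) F), IsOpen Ω ∧ q g ∈ Ω ∧ Set.MapsTo (torusSharp σ) Ω Ω ∧
        ∀ y ∈ bruhatCell (K := F) σ, q y ∈ Ω → (res f : GL (Fin n) F → ℂ) y = 0 := by
    intro res hres3 hres2
    set N := {x | (res f : GL (Fin n) F → ℂ) x ≠ 0} ∩ Z with hN
    have hNc : IsCompact N := SchwartzBruhat.isCompact_ne_inter (res f) hZc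
    have hNC : N ⊆ bruhatCell (K := F) σ := fun x hx => by
      by_contra h; exact hx.1 (hres3 x hx.2 h)
    have hqN : IsCompact (q '' N) := hNc.image_of_continuousOn ((continuousOn_cellTorus σ).mono hNC)
    have hsqN : IsCompact (torusSharp σ '' (q '' N)) := hqN.image (continuous_torusSharp σ)
    refine ⟨(q '' N ∪ torusSharp σ '' (q '' N))ᶜ, (hqN.isClosed.union hsqN.isClosed).isOpen_compl, ?_, ?_, ?_⟩
    · rintro (⟨y, hyN, hyq⟩ | ⟨z, ⟨y, hyN, rfl⟩, hyq⟩)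
      · exact hyN.1 (hres2 y (hNC hyN) (Or.inl hyq))
      · refine hyN.1 (hres2 y (hNC hyN) (Or.inr ?_))
        rw [← hyq, torusSharp_involutive]
    · intro z hz hz'
      apply hz
      rcases hz' with ⟨y, hyN, hyq⟩ | ⟨w, ⟨y, hyN, rfl⟩, hyq⟩
      · exact Or.inr ⟨q y, ⟨y, hyN, rfl⟩, by rw [hyq, torusSharp_involutive]⟩
      · left
        refine ⟨y, hyN, ?_⟩
        have := congrArg (torusSharp σ) hyq
        rwa [torusSharp_involutive, torusSharp_involutive] at this
    · intro y hy hyΩ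
      by_contra h0
      have hyN : y ∈ N := ⟨h0, bruhatCell_subset_levelLT_succ σ hy⟩
      exact hyΩ (Or.inl ⟨y, hyN, rfl⟩)
  -- the dichotomy for the representative `m_g = diag(d) P_σ`
  rcases exists_whittakerCharFun_conj_ne_or_gkInvolution_eq (F := F) hψ1 d σ with
    ⟨u, hu, hu', hne⟩ | hfix
  · ---- the irrelevant case: `res = e`
    set s : ↥(upperUnitriangular (Fin n) F) × ↥(upperUnitriangular (Fin n) F) :=
      (⟨_, hu'⟩, ⟨u, hu⟩) with hs
    have hsm : biAct s (q g * permGL σ) = q g * permGL σ := by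
      rw [biAct_apply, hs, hq, ← hd]
      change diagonalGL (Fin n) F d * permGL σ * u * (diagonalGL (Fin n) F d * permGL σ)⁻¹ *
        (diagonalGL (Fin n) F d * permGL σ) * u⁻¹ = diagonalGL (Fin n) F d * permGL σ
      group
    have hχs : biChar ψ s ≠ 1 := by
      intro h
      apply hne
      have h2 := congrArg (fun x : ℂˣ => (x : ℂ)) h
      simp only [coe_biChar_apply, Units.val_one, hs] at h2
      rwa [mul_inv_eq_one₀ (whittakerCharFun_ne_zero ψ _)] at h2
    obtain ⟨V₀, hV₀o, hV₀c, hCV₀, hτ⟩ := exists_tauStable_compactOpen_subgroup (F := F)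
      (hCu.union ((Set.finite_singleton s.1).union (Set.finite_singleton s.2)).isCompact)
    have hsV : s ∈ V₀.prod V₀ :=
      Subgroup.mem_prod.2 ⟨hCV₀ (Or.inr (Or.inl rfl)), hCV₀ (Or.inr (Or.inr rfl))⟩
    have hunifV := hunif_of_subset hunif (fun x hx => hCV₀ (Or.inl hx))
    -- (P2'): `e f` vanishes on the orbits of `m_g` and `ι(m_g)`
    have hP2 : ∀ y ∈ bruhatCell (K := F) σ, (q y = q g ∨ q y = torusSharp σ (q g)) →
        (biAvg ψ V₀ f : GL (Fin n) F → ℂ) y = 0 := by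
      intro y hy hqy
      rcases hqy with hqy | hqy
      · refine biAvg_apply_eq_zero_of_stabilizer hψ.1 hV₀c hunifV hy hsV ?_ hχs
        have hqy' : cellTorus σ y = cellTorus σ g := hqy
        rw [hqy']; exact hsm
      · by_cases hσ : starPerm σ = σ
        · -- the orbit of `ι(m_g)`, with the witness `flip s`
          rw [torusSharp_of_eq hσ] at hqy
          refine biAvg_apply_eq_zero_of_stabilizer hψ.1 hV₀c hunifV hy (flipU_mem_prod hτ hsV) ?_
            (by rwa [biChar_flipU])
          have hm : q y * permGL σ = gkInvolution (q g * permGL σ) := by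
            rw [hqy, hq, gkInvolution_cellTorus_mul_permGL hσ hg, cellTorus_gkInvolution hσ hg]
          rw [hm, ← gkInvolution_biAct, hsm]
        · rw [torusSharp_of_ne hσ] at hqy
          refine biAvg_apply_eq_zero_of_stabilizer hψ.1 hV₀c hunifV hy hsV ?_ hχs
          have hqy' : cellTorus σ y = cellTorus σ g := hqy
          rw [hqy']; exact hsm
    have hP3 : ∀ φ : SchwartzBruhat (GL (Fin n) F), (∀ x ∈ Z, x ∉ bruhatCell (K := F) σ →
        (φ : GL (Fin n) F → ℂ) x = 0) → ∀ x ∈ Z, x ∉ bruhatCell (K := F) σ →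
        (biAvg ψ V₀ φ : GL (Fin n) F → ℂ) x = 0 :=
      fun φ hφ => biAvg_apply_eq_zero_of_forall ψ hψ.1 hV₀c hφ
    obtain ⟨Ω, hΩo, hgΩ, hΩs, hΩ⟩ := hΩ_of (biAvg ψ V₀) (hP3 f hfZ) hP2
    refine ⟨biAvg ψ V₀, Ω, hΩo, hgΩ, hΩs, fun φ => biRelations_le_gkRelations ψ
      (sub_biAvg_mem_biRelations ψ V₀ hψ.1 hV₀c φ), hP3, hΩ, fun W Ω' hW _ hcompat y hy => ?_⟩
    exact biAvg_cutoff_apply ψ hψ.1 hV₀c hW hcompat hy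
  · ---- the relevant case: `ι(m_g) = m_g`, `σ⋆ = σ`, `res = ½ (e - J e)`
    rw [hd] at hfix
    have hσ : starPerm σ = σ := by
      have h1 : q g * permGL σ ∈ bruhatCell (K := F) σ := cellTorus_mul_permGL_mem σ g
      have h2 := gkInvolution_mem_bruhatCell h1
      rw [hfix] at h2
      exact eq_of_bruhatCell_eq ((parabolicDoubleCoset_eq_or_disjoint (K := F) _ monotone_id
        (starPerm σ) σ).resolve_right (Set.not_disjoint_iff.2 ⟨_, h2, h1⟩))
    have hsharp : torusSharp σ (q g) = q g := by
      rw [torusSharp_of_eq hσ]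
      exact (gkInvolution_cellTorus_mul_permGL_eq_iff hσ hg).1 hfix
    obtain ⟨V₀, hV₀o, hV₀c, hCV₀, hτ⟩ := exists_tauStable_compactOpen_subgroup (F := F) hCu
    have hunifV := hunif_of_subset hunif hCV₀
    set res : SchwartzBruhat (GL (Fin n) F) → SchwartzBruhat (GL (Fin n) F) :=
      fun φ => (2 : ℂ)⁻¹ • (biAvg ψ V₀ φ - SchwartzBruhat.compGKInvolution (biAvg ψ V₀ φ)) with hres
    have hres_apply : ∀ φ x, (res φ : GL (Fin n) F → ℂ) x =
        (2 : ℂ)⁻¹ * ((biAvg ψ V₀ φ : GL (Fin n) F → ℂ) x - (biAvg ψ V₀ φ : GL (Fin n) F → ℂ) (gkInvolution x)) := by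
      intro φ x
      simp only [hres, Submodule.coe_smul, Submodule.coe_sub, Pi.smul_apply, Pi.sub_apply,
        SchwartzBruhat.compGKInvolution_apply, smul_eq_mul]
    have hP1 : ∀ φ, φ - res φ ∈ gkRelations ψ := by
      intro φ
      have : φ - res φ = (φ - biAvg ψ V₀ φ) +
          (2 : ℂ)⁻¹ • (SchwartzBruhat.compGKInvolution (biAvg ψ V₀ φ) + biAvg ψ V₀ φ) := by
        change φ - (2 : ℂ)⁻¹ • (biAvg ψ V₀ φ - SchwartzBruhat.compGKInvolution (biAvg ψ V₀ φ)) = _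
        module
      rw [this]
      exact Submodule.add_mem _ (biRelations_le_gkRelations ψ (sub_biAvg_mem_biRelations ψ V₀ hψ.1 hV₀c φ))
        (Submodule.smul_mem _ _ (compGKInvolution_add_mem_gkRelations ψ _))
    have hP3 : ∀ φ : SchwartzBruhat (GL (Fin n) F), (∀ x ∈ Z, x ∉ bruhatCell (K := F) σ →
        (φ : GL (Fin n) F → ℂ) x = 0) → ∀ x ∈ Z, x ∉ bruhatCell (K := F) σ →
        (res φ : GL (Fin n) F → ℂ) x = 0 := by
      intro φ hφ x hxZ hxC
      have h1 := biAvg_apply_eq_zero_of_forall ψ hψ.1 hV₀c (V₀ := V₀) hφ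
      have h2 := compGKInvolution_apply_eq_zero_of_forall hσ h1 x hxZ hxC
      rw [SchwartzBruhat.compGKInvolution_apply] at h2
      rw [hres_apply, h1 x hxZ hxC, h2, sub_zero, mul_zero]
    have hP2 : ∀ y ∈ bruhatCell (K := F) σ, (q y = q g ∨ q y = torusSharp σ (q g)) →
        (res f : GL (Fin n) F → ℂ) y = 0 := by
      intro y hy hqy
      have hqy' : q y = q g := by
        rcases hqy with h | h
        · exact h
        · rw [h, hsharp]
      have hfixy : gkInvolution (q y * permGL σ) = q y * permGL σ := by rw [hqy']; exact hfix
      rw [hres_apply, biAvg_apply_gkInvolution hψ.1 hV₀c hτ hσ hunifV hy hfixy, sub_self, mul_zero]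
    obtain ⟨Ω, hΩo, hgΩ, hΩs, hΩ⟩ := hΩ_of res (hP3 f hfZ) hP2
    refine ⟨res, Ω, hΩo, hgΩ, hΩs, hP1, hP3, hΩ, fun W Ω' hW hΩ' hcompat y hy => ?_⟩
    rw [hres_apply, hres_apply, biAvg_cutoff_apply ψ hψ.1 hV₀c hW hcompat hy]
    have hιy : gkInvolution y ∈ bruhatCell (K := F) σ := by
      have := (gkInvolution_mem_bruhatCell_iff σ y).2 hy
      rwa [hσ] at this
    rw [biAvg_cutoff_apply ψ hψ.1 hV₀c hW hcompat hιy, cellTorus_gkInvolution_eq_torusSharp hσ hy]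
    have hiff : torusSharp σ (q y) ∈ Ω' ↔ q y ∈ Ω' :=
      ⟨fun h => by simpa [torusSharp_involutive σ (q y)] using hΩ' h, fun h => hΩ' h⟩
    by_cases hqΩ : q y ∈ Ω'
    · rw [if_pos hqΩ, if_pos (hiff.2 hqΩ), if_pos hqΩ]
    · rw [if_neg hqΩ, if_neg (fun h => hqΩ (hiff.1 h)), if_neg hqΩ, sub_zero, mul_zero]

/-! ### The cell step: localization along the torus coordinate -/

open scoped Classical in
/-- **The cell step.** Let `C = C_σ`, `Z = levelLT (rankSum σ + 1) ⊇ C`, and assume that every test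
function vanishing on `Z` lies in `gkRelations ψ`. Then every test function vanishing on `Z ∖ C`
lies in `gkRelations ψ`. (Bernstein's localization principle along `q = cellTorus σ`,
Bernstein–Zelevinsky 1976, §6, in finite-averaging form: cover `q(K) ∪ ♯ q(K)` by the open sets
`Ω_g` of `exists_localData`, pass to a `♯`-stable disjoint compact open refinement and cut `f` off
accordingly.) [cite: GelfandKazhdan1975, §4] [cite: Bump1997, Theorem 4.4.2 proof, pp. 455–457] -/
theorem mem_gkRelations_cell (hψ : ψ.IsContinuousNontrivial) (σ : Equiv.Perm (Fin n))
    (hInv : ∀ φ : SchwartzBruhat (GL (Fin n) F),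
      (∀ x ∈ levelLT (K := F) (rankSum (_root_.id : Fin n → Fin n) σ + 1), (φ : GL (Fin n) F → ℂ) x = 0) →
      φ ∈ gkRelations ψ)
    (f : SchwartzBruhat (GL (Fin n) F))
    (hf : ∀ x ∈ levelLT (K := F) (rankSum (_root_.id : Fin n → Fin n) σ + 1), x ∉ bruhatCell (K := F) σ →
      (f : GL (Fin n) F → ℂ) x = 0) :
    f ∈ gkRelations ψ := by
  haveI : T2Space F := (GaloisRepresentations.IsNonarchimedeanLocalField.isLocalField F).toT2Space
  set Z := levelLT (K := F) (rankSum (_root_.id : Fin n → Fin n) σ + 1) with hZ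
  have hZc : IsClosed Z := isClosed_levelLT _
  -- the compact part `K` of the support inside `Z`, contained in the cell
  set K := {x | (f : GL (Fin n) F → ℂ) x ≠ 0} ∩ Z with hK
  have hKc : IsCompact K := SchwartzBruhat.isCompact_ne_inter f hZc
  have hKC : K ⊆ bruhatCell (K := F) σ := fun x hx => by
    by_contra h; exact hx.1 (hf x hx.2 h)
  have hKZ : ∀ y ∈ bruhatCell (K := F) σ, (f : GL (Fin n) F → ℂ) y ≠ 0 → y ∈ K :=
    fun y hy h0 => ⟨h0, bruhatCell_subset_levelLT_succ σ hy⟩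
  -- uniformity
  obtain ⟨C_u, hCu, hdec⟩ := exists_isCompact_forall_eq_mul_cellTorus_mul σ hKc hKC
  have hunif : ∀ y ∈ bruhatCell (K := F) σ, (f : GL (Fin n) F → ℂ) y ≠ 0 →
      ∃ u₁ ∈ C_u, ∃ u₂ ∈ C_u, y = (u₁ : GL (Fin n) F) * (cellTorus σ y * permGL σ) * (u₂ : GL (Fin n) F) :=
    fun y hy h0 => hdec y (hKZ y hy h0)
  -- local data at every point of the cell
  have hloc : ∀ g ∈ bruhatCell (K := F) σ, _ := fun g hg => exists_localData ψ hψ σ hf hCu hunif hg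
  choose! res Ω hΩo hgΩ hΩs hP1 hP3 hP2 hP4 using hloc
  -- the compact `Q = q(K) ∪ ♯ q(K)` and a finite subcover by the `Ω g`, `g ∈ K`
  set Q := cellTorus σ '' K ∪ torusSharp σ '' (cellTorus σ '' K) with hQ
  have hqK : IsCompact (cellTorus σ '' K) := hKc.image_of_continuousOn ((continuousOn_cellTorus σ).mono hKC)
  have hQc : IsCompact Q := hqK.union (hqK.image (continuous_torusSharp σ))
  have hQcov : Q ⊆ ⋃ g ∈ K, Ω g := by
    rintro z (⟨g, hgK, rfl⟩ | ⟨w, ⟨g, hgK, rfl⟩, rfl⟩)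
    · exact Set.mem_biUnion hgK (hgΩ g (hKC hgK))
    · exact Set.mem_biUnion hgK (hΩs g (hKC hgK) (hgΩ g (hKC hgK)))
  obtain ⟨t, htK, htfin, htcov⟩ := hQc.elim_finite_subcover_image (fun g hg => hΩo g (hKC hg)) hQcov
  haveI : Fintype ↥t := htfin.fintype
  -- a `♯`-stable disjoint compact open refinement
  obtain ⟨Ω', hΩ'c, -, hΩ's, hΩ'Ω, hΩ'd, hΩ'cov⟩ := exists_sharp_refinement (ι := ↥t)
    (continuous_torusSharp σ) (torusSharp_involutive σ) hQc (Ω := fun i => Ω (i : GL (Fin n) F))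
    (fun i => hΩo _ (hKC (htK i.2))) (fun i => hΩs _ (hKC (htK i.2)))
    (fun z hz => by
      obtain ⟨g, hgt, hz⟩ := Set.mem_iUnion₂.1 (htcov hz)
      exact Set.mem_iUnion.2 ⟨⟨g, hgt⟩, hz⟩)
  -- the pieces `P i = K ∩ q⁻¹(Ω' i)` and disjoint compact open `W i ⊇ P i`
  set P : ↥t → Set (GL (Fin n) F) := fun i => K ∩ cellTorus σ ⁻¹' Ω' i with hP
  have hPc : ∀ i, IsCompact (P i) := fun i =>
    hKc.of_isClosed_subset (((continuousOn_cellTorus σ).mono hKC).preimage_isClosed_of_isClosed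
      hKc.isClosed (hΩ'c i).isClosed) Set.inter_subset_left
  have hPd : Pairwise (Function.onFun Disjoint P) := fun i j hij =>
    Set.disjoint_left.2 fun x hxi hxj => Set.disjoint_left.1 (hΩ'd hij) hxi.2 hxj.2
  obtain ⟨W, hWc, hWo, hPW, hWd⟩ := exists_disjoint_isCompact_isOpen hPc hPd
  have hWcl : ∀ i, IsClopen (W i) := fun i => ⟨(hWc i).isClosed, hWo i⟩
  -- the index of a point of `K`
  have hidx : ∀ x ∈ K, ∃ i, cellTorus σ x ∈ Ω' i := fun x hx =>
    Set.mem_iUnion.1 (hΩ'cov (Or.inl ⟨x, hx, rfl⟩))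
  have huniq : ∀ x i j, x ∈ W i → x ∈ W j → i = j := fun x i j hi hj => by
    by_contra hij; exact Set.disjoint_left.1 (hWd hij) hi hj
  -- the cut-offs
  set fc : ↥t → SchwartzBruhat (GL (Fin n) F) := fun i => SchwartzBruhat.cutoff (W i) (hWcl i) f with hfc
  have hfc_apply : ∀ i x, (fc i : GL (Fin n) F → ℂ) x = if x ∈ W i then (f : GL (Fin n) F → ℂ) x else 0 :=
    fun i x => SchwartzBruhat.cutoff_apply _ _ _ _
  -- (a) `f - ∑ fc i` vanishes on `Z`
  have hsum : ∀ x ∈ Z, ((f - ∑ i, fc i : SchwartzBruhat (GL (Fin n) F)) : GL (Fin n) F → ℂ) x = 0 := by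
    intro x hxZ
    rw [Submodule.coe_sub, Pi.sub_apply, Submodule.coe_sum, Finset.sum_apply]
    by_cases h0 : (f : GL (Fin n) F → ℂ) x = 0
    · rw [h0, zero_sub, neg_eq_zero]
      exact Finset.sum_eq_zero fun i _ => by rw [hfc_apply]; split_ifs <;> simp [h0]
    · have hxK : x ∈ K := ⟨h0, hxZ⟩
      obtain ⟨i, hqi⟩ := hidx x hxK
      have hxW : x ∈ W i := hPW i ⟨hxK, hqi⟩
      rw [Finset.sum_eq_single i, hfc_apply, if_pos hxW, sub_self]
      · intro j _ hji
        rw [hfc_apply, if_neg (fun hxj => hji (huniq x j i hxj hxW))]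
      · exact fun h => absurd (Finset.mem_univ i) h
  have hmem1 : f - ∑ i, fc i ∈ gkRelations ψ := hInv _ hsum
  -- (b) each `fc i` lies in `gkRelations ψ`
  have hmem2 : ∀ i, fc i ∈ gkRelations ψ := by
    intro i
    have hgC : (i : GL (Fin n) F) ∈ bruhatCell (K := F) σ := hKC (htK i.2)
    have hcompat : ∀ y ∈ bruhatCell (K := F) σ, (f : GL (Fin n) F → ℂ) y ≠ 0 →
        (y ∈ W i ↔ cellTorus σ y ∈ Ω' i) := by
      intro y hy h0
      have hyK : y ∈ K := hKZ y hy h0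
      refine ⟨fun hyW => ?_, fun hq' => hPW i ⟨hyK, hq'⟩⟩
      obtain ⟨j, hqj⟩ := hidx y hyK
      rw [huniq y i j hyW (hPW j ⟨hyK, hqj⟩)]
      exact hqj
    have hfiZ : ∀ x ∈ Z, x ∉ bruhatCell (K := F) σ → (fc i : GL (Fin n) F → ℂ) x = 0 := by
      intro x hxZ hxC
      rw [hfc_apply]
      split_ifs
      · exact hf x hxZ hxC
      · rfl
    have hvan : ∀ x ∈ Z, (res (i : GL (Fin n) F) (fc i) : GL (Fin n) F → ℂ) x = 0 := by
      intro x hxZ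
      by_cases hxC : x ∈ bruhatCell (K := F) σ
      · rw [hP4 _ hgC (W i) (Ω' i) (hWcl i) (hΩ's i) hcompat x hxC]
        by_cases hqx : cellTorus σ x ∈ Ω' i
        · rw [if_pos hqx]
          exact hP2 _ hgC x hxC (hΩ'Ω i hqx)
        · rw [if_neg hqx]
      · exact hP3 _ hgC (fc i) hfiZ x hxZ hxC
    have h1 := hP1 _ hgC (fc i)
    have h2 : res (i : GL (Fin n) F) (fc i) ∈ gkRelations ψ := hInv _ hvan
    have : fc i = (fc i - res (i : GL (Fin n) F) (fc i)) + res (i : GL (Fin n) F) (fc i) := by abel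
    rw [this]
    exact Submodule.add_mem _ h1 h2
  have : f = (f - ∑ i, fc i) + ∑ i, fc i := by abel
  rw [this]
  exact Submodule.add_mem _ hmem1 (Submodule.sum_mem _ fun i _ => hmem2 i)

/-! ### The induction over the levels and Theorem A -/

open scoped Classical in
/-- **The induction step over the levels**: if every test function vanishing on `levelLT (r + 1)`
lies in `gkRelations ψ`, then so does every test function vanishing on `levelLT r` (cut `f` off
along disjoint compact open neighbourhoods of the compact pieces of its support in the finitely
many cells of rank sum `r`, which are relatively open in `levelLT (r + 1)`, and apply the cell
step to each piece). [cite: GelfandKazhdan1975, §4] -/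
theorem mem_gkRelations_step (hψ : ψ.IsContinuousNontrivial) (r : ℕ)
    (hInv : ∀ φ : SchwartzBruhat (GL (Fin n) F),
      (∀ x ∈ levelLT (K := F) (r + 1), (φ : GL (Fin n) F → ℂ) x = 0) → φ ∈ gkRelations ψ)
    (f : SchwartzBruhat (GL (Fin n) F)) (hf : ∀ x ∈ levelLT (K := F) r, (f : GL (Fin n) F → ℂ) x = 0) :
    f ∈ gkRelations ψ := by
  haveI : T2Space F := (GaloisRepresentations.IsNonarchimedeanLocalField.isLocalField F).toT2Space
  set Z := levelLT (K := F) (n := n) (r + 1) with hZ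
  have hZc : IsClosed Z := isClosed_levelLT _
  set K := {x | (f : GL (Fin n) F → ℂ) x ≠ 0} ∩ Z with hK
  have hKc : IsCompact K := SchwartzBruhat.isCompact_ne_inter f hZc
  -- every point of `K` lies in a cell of rank sum `r`
  have hKcell : ∀ x ∈ K, ∃ τ : Equiv.Perm (Fin n),
      rankSum (_root_.id : Fin n → Fin n) τ = r ∧ x ∈ bruhatCell (K := F) τ := by
    intro x hx
    rcases (mem_levelLT_succ_iff (K := F) r x).1 hx.2 with h | h
    · exact absurd (hf x h) hx.1
    · exact h
  -- the pieces `P τ = K ∩ C_τ` are `K ∩ O τ` for open sets `O τ`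
  have hO : ∀ τ : Equiv.Perm (Fin n), ∃ O : Set (GL (Fin n) F), IsOpen O ∧ K ∩ bruhatCell (K := F) τ = K ∩ O := by
    intro τ
    by_cases hτ : rankSum (_root_.id : Fin n → Fin n) τ = r
    · have hN : ∀ x ∈ bruhatCell (K := F) τ, ∃ N : Set (GL (Fin n) F), IsOpen N ∧ x ∈ N ∧
          N ∩ Z ⊆ bruhatCell (K := F) τ := fun x hx => by
        obtain ⟨N, hNo, hxN, hNsub⟩ := exists_isOpen_inter_levelLT_subset (K := F) τ hx
        exact ⟨N, hNo, hxN, by rw [hZ, ← hτ]; exact hNsub⟩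
      choose! N hNo hxN hNsub using hN
      refine ⟨⋃ x ∈ bruhatCell (K := F) τ, N x, isOpen_biUnion fun x hx => hNo x hx, ?_⟩
      ext y
      constructor
      · rintro ⟨hyK, hyC⟩
        exact ⟨hyK, Set.mem_biUnion hyC (hxN y hyC)⟩
      · rintro ⟨hyK, hyO⟩
        obtain ⟨x, hxC, hyN⟩ := Set.mem_iUnion₂.1 hyO
        exact ⟨hyK, hNsub x hxC ⟨hyN, hyK.2⟩⟩
    · refine ⟨∅, isOpen_empty, ?_⟩
      rw [Set.inter_empty]
      ext y
      simp only [Set.mem_inter_iff, Set.mem_empty_iff_false, iff_false, not_and]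
      intro hyK hyC
      obtain ⟨τ', hτ', hyC'⟩ := hKcell y hyK
      have : τ = τ' := by
        by_contra h
        exact Set.disjoint_left.1 (disjoint_bruhatCell (K := F) h) hyC hyC'
      exact hτ (this ▸ hτ')
  choose O hOo hPO using hO
  set P : Equiv.Perm (Fin n) → Set (GL (Fin n) F) := fun τ => K ∩ bruhatCell (K := F) τ with hP
  have hPd : Pairwise (Function.onFun Disjoint P) := fun τ τ' h =>
    Set.disjoint_left.2 fun x hx hx' => Set.disjoint_left.1 (disjoint_bruhatCell (K := F) h) hx.2 hx'.2
  have hPc : ∀ τ, IsCompact (P τ) := by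
    intro τ
    have heq : P τ = K \ ⋃ (τ' : Equiv.Perm (Fin n)) (_ : τ' ≠ τ), O τ' := by
      ext x
      constructor
      · intro hx
        refine ⟨hx.1, ?_⟩
        simp only [Set.mem_iUnion, not_exists]
        intro τ' hτ' hxO
        have hx' : x ∈ P τ' := by change x ∈ K ∩ bruhatCell τ'; rw [hPO τ']; exact ⟨hx.1, hxO⟩
        exact Set.disjoint_left.1 (hPd (Ne.symm hτ')) hx hx'
      · rintro ⟨hxK, hxO⟩
        obtain ⟨τ₀, -, hxC⟩ := hKcell x hxK
        by_cases h : τ₀ = τ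
        · exact ⟨hxK, h ▸ hxC⟩
        · exfalso
          apply hxO
          have : x ∈ K ∩ O τ₀ := by rw [← hPO τ₀]; exact ⟨hxK, hxC⟩
          exact Set.mem_biUnion h this.2
    rw [heq]
    exact hKc.diff (isOpen_biUnion fun τ' _ => hOo τ')
  obtain ⟨W, hWc, hWo, hPW, hWd⟩ := exists_disjoint_isCompact_isOpen hPc hPd
  have hWcl : ∀ τ, IsClopen (W τ) := fun τ => ⟨(hWc τ).isClosed, hWo τ⟩
  have huniq : ∀ x τ τ', x ∈ W τ → x ∈ W τ' → τ = τ' := fun x τ τ' h h' => by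
    by_contra hne; exact Set.disjoint_left.1 (hWd hne) h h'
  set fc : Equiv.Perm (Fin n) → SchwartzBruhat (GL (Fin n) F) :=
    fun τ => SchwartzBruhat.cutoff (W τ) (hWcl τ) f with hfc
  have hfc_apply : ∀ τ x, (fc τ : GL (Fin n) F → ℂ) x = if x ∈ W τ then (f : GL (Fin n) F → ℂ) x else 0 :=
    fun τ x => SchwartzBruhat.cutoff_apply _ _ _ _
  -- for `x ∈ K`: its cell `τ₀`, and `x ∈ W τ₀`
  have hxW : ∀ x ∈ K, ∃ τ₀, rankSum (_root_.id : Fin n → Fin n) τ₀ = r ∧ x ∈ bruhatCell (K := F) τ₀ ∧ x ∈ W τ₀ :=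
    fun x hx => by
      obtain ⟨τ₀, hτ₀, hxC⟩ := hKcell x hx
      exact ⟨τ₀, hτ₀, hxC, hPW τ₀ ⟨hx, hxC⟩⟩
  -- (a) `f - ∑ fc τ` vanishes on `Z`
  have hsum : ∀ x ∈ Z, ((f - ∑ τ, fc τ : SchwartzBruhat (GL (Fin n) F)) : GL (Fin n) F → ℂ) x = 0 := by
    intro x hxZ
    rw [Submodule.coe_sub, Pi.sub_apply, Submodule.coe_sum, Finset.sum_apply]
    by_cases h0 : (f : GL (Fin n) F → ℂ) x = 0
    · rw [h0, zero_sub, neg_eq_zero]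
      exact Finset.sum_eq_zero fun τ _ => by rw [hfc_apply]; split_ifs <;> simp [h0]
    · obtain ⟨τ₀, -, -, hxW₀⟩ := hxW x ⟨h0, hxZ⟩
      rw [Finset.sum_eq_single τ₀, hfc_apply, if_pos hxW₀, sub_self]
      · intro τ _ hne
        rw [hfc_apply, if_neg (fun hxτ => hne (huniq x τ τ₀ hxτ hxW₀))]
      · exact fun h => absurd (Finset.mem_univ τ₀) h
  have hmem1 : f - ∑ τ, fc τ ∈ gkRelations ψ := hInv _ hsum
  -- (b) each `fc τ` lies in `gkRelations ψ`
  have hmem2 : ∀ τ, fc τ ∈ gkRelations ψ := by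
    intro τ
    -- `fc τ` vanishes on `Z` off the cell of `τ`
    have hoff : ∀ x ∈ Z, x ∉ bruhatCell (K := F) τ → (fc τ : GL (Fin n) F → ℂ) x = 0 := by
      intro x hxZ hxC
      rw [hfc_apply]
      by_cases h0 : (f : GL (Fin n) F → ℂ) x = 0
      · split_ifs <;> simp [h0]
      · obtain ⟨τ₀, -, hxC₀, hxW₀⟩ := hxW x ⟨h0, hxZ⟩
        have hne : τ ≠ τ₀ := fun h => hxC (h ▸ hxC₀)
        rw [if_neg (fun hxτ => hne (huniq x τ τ₀ hxτ hxW₀))]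
    by_cases hτ : rankSum (_root_.id : Fin n → Fin n) τ = r
    · refine mem_gkRelations_cell ψ hψ τ (fun φ hφ => hInv φ ?_) (fc τ) ?_
      · rw [hτ] at hφ; exact hφ
      · rw [hτ]; exact hoff
    · refine hInv _ fun x hxZ => ?_
      by_cases hxC : x ∈ bruhatCell (K := F) τ
      · rw [hfc_apply]
        by_cases h0 : (f : GL (Fin n) F → ℂ) x = 0
        · split_ifs <;> simp [h0]
        · exfalso
          obtain ⟨τ₀, hτ₀, hxC₀, -⟩ := hxW x ⟨h0, hxZ⟩
          have : τ = τ₀ := by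
            by_contra h
            exact Set.disjoint_left.1 (disjoint_bruhatCell (K := F) h) hxC hxC₀
          exact hτ (this ▸ hτ₀)
      · exact hoff x hxZ hxC
  have : f = (f - ∑ τ, fc τ) + ∑ τ, fc τ := by abel
  rw [this]
  exact Submodule.add_mem _ hmem1 (Submodule.sum_mem _ fun τ _ => hmem2 τ)

/-- **Every test function vanishing on `levelLT r` lies in `gkRelations ψ`** (downward induction
on `r` from a level exhausting `GL_n(F)`). [cite: GelfandKazhdan1975, §4] -/
theorem mem_gkRelations_of_forall_levelLT (hψ : ψ.IsContinuousNontrivial) (r : ℕ)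
    (f : SchwartzBruhat (GL (Fin n) F)) (hf : ∀ x ∈ levelLT (K := F) r, (f : GL (Fin n) F → ℂ) x = 0) :
    f ∈ gkRelations ψ := by
  set R₀ := (Finset.univ.sup fun σ : Equiv.Perm (Fin n) => rankSum (_root_.id : Fin n → Fin n) σ) + 1 with hR₀
  have huniv : levelLT (K := F) (n := n) R₀ = Set.univ := levelLT_eq_univ fun τ => rankSum_lt_sup_succ τ
  have key : ∀ k : ℕ, ∀ φ : SchwartzBruhat (GL (Fin n) F),
      (∀ x ∈ levelLT (K := F) (R₀ - k), (φ : GL (Fin n) F → ℂ) x = 0) → φ ∈ gkRelations ψ := by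
    intro k
    induction k with
    | zero =>
      intro φ hφ
      have : φ = 0 := by
        apply Subtype.ext; funext x
        exact hφ x (by rw [Nat.sub_zero, huniv]; exact Set.mem_univ x)
      rw [this]
      exact Submodule.zero_mem _
    | succ k ih =>
      intro φ hφ
      rcases Nat.lt_or_ge k R₀ with hk | hk
      · have hr1 : R₀ - k = (R₀ - (k + 1)) + 1 := by omega
        rw [hr1] at ih
        exact mem_gkRelations_step ψ hψ _ ih φ hφ
      · have : R₀ - (k + 1) = R₀ - k := by omega
        rw [this] at hφ
        exact ih φ hφ
  rcases le_or_gt r R₀ with hr | hr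
  · have := key (R₀ - r) f
    rw [Nat.sub_sub_self hr] at this
    exact this hf
  · exact key 0 f fun x _ => hf x (by
      rw [levelLT_eq_univ fun τ => lt_trans (rankSum_lt_sup_succ τ) hr]; exact Set.mem_univ x)

/-- **`gkRelations ψ` is everything**, for a non-trivial continuous `ψ`. [cite: GelfandKazhdan1975, §4] -/
theorem gkRelations_eq_top (hψ : ψ.IsContinuousNontrivial) : gkRelations (n := n) ψ = ⊤ :=
  Submodule.eq_top_iff'.2 fun f => mem_gkRelations_of_forall_levelLT ψ hψ 0 f
    (fun x hx => by simp at hx)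

/-- **Gelfand–Kazhdan's theorem on bi-`ψ_U`-quasi-invariant distributions (Theorem A), all `n`.**
For a non-trivial continuous additive character `ψ` of the non-archimedean local field `F`, every
distribution `Δ` on `GL_n(F)` with `Δ(λ(u) φ) = ψ_U(u) Δ(φ)` and `Δ(ρ(u) φ) = ψ_U(u)⁻¹ Δ(φ)` for all
`u ∈ U_n` (Bump's (4.1) in the conventions (3.4)–(3.5) of p. 435) is stable under the
anti-involution `ι(g) = w⁰ ᵗg w⁰`: `Δ(φ ∘ ι) = Δ(φ)`. (Gelfand–Kazhdan 1975, §§3–4, the main lemma of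
the uniqueness of Whittaker models; Bernstein–Zelevinsky 1976, §§5.16–5.17 and §7; Bump 1997,
Thm. 4.4.2, proved there for `n = 2`. Here for all `n`, in the exact form of the hypothesis `hA` of
`rank_whittakerFunctionals_le_one_of_gelfandKazhdan`.) The proof is `gkRelations_eq_top` combined
with `gkInvolution_stable_of_gkRelations_eq_top`.
[cite: GelfandKazhdan1975, §§3–4] [cite: Bump1997, Theorem 4.4.2, p. 455] -/
theorem biWhittaker_gkInvolution_stable (hψ : ψ.IsContinuousNontrivial)
    (Δ : Module.Dual ℂ (SchwartzBruhat (GL (Fin n) F)))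
    (hl : ∀ (u : ↥(upperUnitriangular (Fin n) F)) (φ : SchwartzBruhat (GL (Fin n) F)),
      Δ (SchwartzBruhat.leftTranslate (u : GL (Fin n) F) φ) = whittakerCharFun ψ u * Δ φ)
    (hr : ∀ (u : ↥(upperUnitriangular (Fin n) F)) (φ : SchwartzBruhat (GL (Fin n) F)),
      Δ (SchwartzBruhat.rightTranslate (u : GL (Fin n) F) φ) = (whittakerCharFun ψ u)⁻¹ * Δ φ)
    (φ : SchwartzBruhat (GL (Fin n) F)) : Δ (SchwartzBruhat.compGKInvolution φ) = Δ φ :=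
  gkInvolution_stable_of_gkRelations_eq_top ψ (gkRelations_eq_top ψ hψ) Δ hl hr φ

end LocalField

end Literature.NumberTheory.Automorphic
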